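import Summits.ResolutionOfSingularities.ResolutionOfSingularities.Theorems.AdaptedChartHensel2
import HarnessLib

/-!
# AdaptedChartHensel3 — decomp-res node «HenselLadder» PART VI ((K-H), lens-1 g22 ADDENDUM), tree companion

Content VERBATIM from PART VI of the decomp-res lens-1 g22 node `HOME/decomp-res-lens-1/g22/HenselLadder.lean`
(HOME = run/shared/lean/pub/decomp-res; ADDENDUM-g22.md), re-namespaced `…Theorems.AdaptedChartHensel` (one namespace
across the three companion files `AdaptedChartHensel`, `AdaptedChartHensel2`, `AdaptedChartHensel3`, split for the
400-line cap), typed against the LANDED `Theorems.HenselKeyChainLU` (p803393), `Literature…KollarEtaleCoordinates`,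
`Literature.RingTheory.Flat` (via the tree) and Mathlib's standard-étale API; nothing inlined; a pure addition (no
existing file touched).  Landing target:
`Summits/ResolutionOfSingularities/ResolutionOfSingularities/Theorems/AdaptedChartHensel3.lean`
(`--kind proof --supports stmt-ResolutionOfSingularities-0641`, HELPER file of the host route `Valuative`).

WINDOW g23 item (K-H) (CRITIC-LEDGER row 167): THEOREM H (⟸) IN KERNEL — every rank-one place with residue field `k`
that admits a (value-)ADAPTED REGULAR CHART on some finite-type model lies in the Hensel cell
`HenselKeyChainTopBelow k O`, MODULO THEOREM D typed as the hypothesis `TheoremD k` (window: «D admissible as a TYPED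
hypothesis»; THEOREM D = g21 ADDENDUM, row 163a, to be landed as item (K-D) against `TheoremD k`).  The étale local
structure (EGA IV 18.4.6 (ii)) is NOT ported: it is assembled in kernel from miracle flatness (tree, EGA IV 6.1.5),
Kollár's unramified coordinates (tree), flat + unramified ⇒ étale (tree, EGA IV 17.6.1) and Mathlib's
`Algebra.IsEtaleAt.exists_isStandardEtale` (Stacks 00UE) + `StandardEtalePresentation`.

THIS FILE: §VI.4 (second half) `monomiallyRational_comap_adjoin` and THE LAW
`henselKeyChainTopBelow_of_adaptedRegularChart`;
§VI.5 `AdaptedRegularChart` (the window's literal shape), `frame_spans_of_not_isAbhyankarPlace` (KK05 Thm 2.1, tree),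
`algebraicIndependent_of_adaptedRegularChart`, and THE LAW IN THE RESIDUAL BINDERS
`henselKeyChainTopBelow_of_adaptedRegularChart_residual`.
-/

noncomputable section

open IsLocalRing Literature.AlgebraicGeometry.Resolution
open Summit.ResolutionOfSingularities.ResolutionOfSingularities.Theorems
open Summit.ResolutionOfSingularities.ResolutionOfSingularities.Theorems.KeyChainLU
open Summit.ResolutionOfSingularities.ResolutionOfSingularities.Theorems.HenselKeyChainLU

namespace Summit.ResolutionOfSingularities.ResolutionOfSingularities.Theorems.AdaptedChartHensel

section AdaptedChart

open Polynomial

variable {k : Type} [Field k] {K : Type} [Field K] [Algebra k K]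

/-! ### VI.4 (continued) -/

/-- **Transport of the frame to the rational sub-top.**  If `u₀, …, u₃ ∈ O` are non-zero and
algebraically independent over `k`, with `v u₀, v u₁, v u₂` ℤ-independent and spanning `ℚ ⊗ Γ`, then
`F₁ = k(u₀, …, u₃)` with the restricted valuation ring `O ∩ F₁` is MONOMIALLY RATIONAL. [folklore] -/
theorem monomiallyRational_comap_adjoin (O : ValuationSubring K) (u : Fin 4 → K)
    (huO : ∀ i, u i ∈ O) (hu0 : ∀ i, u i ≠ 0) (hindu : AlgebraicIndependent k u)
    (hind : ∀ m : Fin 3 → ℤ,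
      (∏ i : Fin 3, O.valuation (u (Fin.castSucc i)) ^ m i) = 1 → m = 0)
    (hspan : ∀ x : K, x ≠ 0 → ∃ E : ℕ, 0 < E ∧ ∃ m : Fin 3 → ℤ,
      O.valuation x ^ E = ∏ i : Fin 3, O.valuation (u (Fin.castSucc i)) ^ m i) :
    MonomiallyRational k
      (O.comap (algebraMap (IntermediateField.adjoin k (Set.range u)) K)) := by
  set F₁ : IntermediateField k K := IntermediateField.adjoin k (Set.range u) with hF₁def
  let ι : F₁ →+* K := algebraMap F₁ K
  let y : Fin 4 → F₁ := fun i => ⟨u i, IntermediateField.subset_adjoin k _ ⟨i, rfl⟩⟩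
  have hyu : ∀ i, ι (y i) = u i := fun _ => rfl
  have hy0 : ∀ i, y i ≠ 0 := fun i h => hu0 i (congrArg Subtype.val h)
  have hιprod : ∀ m : Fin 3 → ℤ,
      ι (∏ i : Fin 3, y (Fin.castSucc i) ^ m i) = ∏ i : Fin 3, u (Fin.castSucc i) ^ m i := by
    intro m
    rw [map_prod]
    simp only [map_zpow₀, hyu]
  refine ⟨y, hy0, fun i => huO i, AlgebraicIndependent.of_comp F₁.val hindu, ?_, ?_, ?_⟩
  · refine eq_top_iff.mpr fun z _ => ?_
    have hz : (z : K) ∈ IntermediateField.adjoin k (Set.range u) := z.2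
    have hrange : Set.range u = F₁.val '' Set.range y := by
      rw [← Set.range_comp]
      rfl
    rw [hrange, ← IntermediateField.adjoin_map] at hz
    rw [IntermediateField.mem_map] at hz
    obtain ⟨w, hw, hwz⟩ := hz
    have : w = z := Subtype.ext hwz
    exact this ▸ hw
  · intro m hm
    apply hind m
    rw [prod_valuation_zpow_eq] at hm ⊢
    rw [comap_valuation_eq_one_iff, hιprod] at hm
    exact hm
  · intro x hx0
    obtain ⟨E, hE, m, hm⟩ := hspan (ι x) ((map_ne_zero ι).mpr hx0)
    refine ⟨E, hE, m, ?_⟩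
    rw [prod_valuation_zpow_eq, ← map_pow, comap_valuation_eq_iff, map_pow, hιprod, map_pow,
      ← prod_valuation_zpow_eq]
    exact hm

/-- **(K-H) THEOREM H (⟸) in kernel — value-adapted regular charts lie in the Hensel cell.**
Let `v` be a rank-one valuation of `K ⊇ k` with residue field `κ(v) = k` (`hκ`), and let
`(A, u₀, …, u₃)` be a VALUE-ADAPTED REGULAR CHART of `(K, v)` (`ValueAdaptedRegularChart`).  Then, granted
THEOREM D (`hD`), `O_v` lies in the decided cell `HenselKeyChainTopBelow k O_v`, with sub-top
`F₁ = k(u₀, u₁, u₂, u₃)`.  PROOF (all in kernel, no port).  Let `P = k[X₀..X₃] → A`, `Xᵢ ↦ uᵢ`, `𝔮` the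
centre, `𝔭 = 𝔮 ∩ P`.  (1) `P_𝔭 → A_𝔮` is a local map of regular local rings whose fibre ideal `𝔭A_𝔮 = (u)A_𝔮`
is the maximal ideal, so the fibre is a field and `dim P_𝔭 + 0 ≤ 4 = dim A_𝔮`: MIRACLE FLATNESS
(`Literature.RingTheory.Flat.flat_of_isRegularLocalRing_of_isRegularLocalRing_fiber`, EGA IV 6.1.5) gives
`A_𝔮` flat over `P_𝔭`.  (2) `κ(A_𝔮) = k` (from `κ(v) = k` and `A ⊆ O_v`) and `(u) = 𝔪_{A_𝔮}`, so `P → A_𝔮`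
is formally unramified (`formallyUnramified_mvPolynomial_of_span_eq_maximalIdeal`: `Ω_{A_𝔮/k}` is generated
by the `duᵢ`).  (3) EGA IV 17.6.1 (`isEtaleAt_of_flat_of_formallyUnramified_localization`): `A` is ÉTALE over
`P` at `𝔮`; by the local structure of étale algebras (Mathlib `Algebra.IsEtaleAt.exists_isStandardEtale`,
Stacks 00UE) some `A[1/r]`, `r ∉ 𝔮`, is STANDARD ÉTALE over `P`: `A[1/r] ≅ P[X][Y]/(f, Yg-1)`.  (4) Since
`v r = 0`, `A[1/r] ⊆ O_v`; the standard generator `η` is a Hensel root over `O_v ∩ k(u)` generating `K`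
(`henselDatum_of_standardEtalePresentation`).  (5) Faithful flatness of `P_𝔭 → A_𝔮` makes `P → A` injective:
`u₀, …, u₃` are algebraically independent, so `F₁ = k(u)` is purely transcendental; the frame clauses and
`κ = k`, rank one transport to `O_v ∩ F₁` (`rankOne_comap`), i.e. `F₁` is MONOMIALLY RATIONAL; THEOREM D
gives its key chain.  This is EGA IV 18.4.6 (ii) / Milne I 3.14 ("a closed point with a regular system of
parameters is an étale neighbourhood of the origin of 𝔸ⁿ") re-proved inside the kernel from Mathlib's
étale API, composed with Knaf–Kuhlmann's dictionary `K ⊆ F₁^h ⟺` Hensel root (KK09 Lemma 3.7).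
[Grothendieck1967, Prop. 18.4.6 (ii), Thm. 17.6.1, Prop. 6.1.5] [KnafKuhlmann2009 = arXiv:math/0702856,
Lemma 3.7] [folklore] -/
theorem henselKeyChainTopBelow_of_adaptedRegularChart (hD : TheoremD k) (O : ValuationSubring K)
    (hr : Nonempty O.valuation.RankOne)
    (hκ : ∀ y ∈ O, ∃ c : k, y - algebraMap k K c ∈ O.nonunits)
    (hA : ValueAdaptedRegularChart k O) : HenselKeyChainTopBelow k O := by
  classical
  obtain ⟨A, hAO, u, hu, hAfg, hfrac, hreg, hdim, hmax, hind, hspan⟩ := hA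
  haveI := hfrac
  have hAO' : ∀ a : A, (a : K) ∈ O := fun a => hAO a.2
  have hmem𝔔 : ∀ a : A, a ∈ centreIdeal A O hAO ↔ O.valuation (a : K) < 1 := fun a =>
    KeyChainLU.mem_centreIdeal_iff A hAO a
  -- the parameter algebra `P = k[X₀..X₃] → A`, `Xᵢ ↦ uᵢ`
  let P := MvPolynomial (Fin 4) k
  let u' : Fin 4 → A := fun i => ⟨u i, hu i⟩
  letI algPA : Algebra P A := (MvPolynomial.aeval u').toRingHom.toAlgebra
  have halgPA : ∀ q : P, algebraMap P A q = MvPolynomial.aeval u' q := fun _ => rfl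
  haveI : IsScalarTower k P A := IsScalarTower.of_algebraMap_eq fun c => by
    rw [halgPA, MvPolynomial.algebraMap_eq, MvPolynomial.aeval_C]
  have hX : ∀ i, algebraMap P A (MvPolynomial.X i) = u' i := fun i => by
    rw [halgPA, MvPolynomial.aeval_X]
  -- (1)–(3) standard-étale neighbourhood of the centre, algebraic independence of `u`
  obtain ⟨hinjPA, r, hr𝔔, hstd⟩ :=
    exists_isStandardEtale_of_regularParameters O A hAO u' hX hAfg hκ hreg hdim hmax
  have hr1 : O.valuation (r : K) = 1 := by
    have hle := (O.valuation_le_one_iff _).mpr (hAO' r)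
    exact (hle.lt_or_eq).resolve_left fun h => hr𝔔 ((hmem𝔔 r).mpr h)
  obtain ⟨Q⟩ := hstd.nonempty_standardEtalePresentation
  have hindu : AlgebraicIndependent k u := by
    rw [algebraicIndependent_iff_injective_aeval]
    have : MvPolynomial.aeval (R := k) u = A.val.comp (MvPolynomial.aeval u') := by
      rw [MvPolynomial.comp_aeval]
      rfl
    rw [this, AlgHom.coe_comp]
    exact Subtype.val_injective.comp hinjPA
  have hu0 : ∀ i, u i ≠ 0 := fun i => hindu.ne_zero i
  -- (4) the Hensel datum over `F₁ = k(u)`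
  set F₁ : IntermediateField k K := IntermediateField.adjoin k (Set.range u) with hF₁def
  have huA : ∀ q : P, ((MvPolynomial.aeval u' q : A) : K) = MvPolynomial.aeval u q := by
    intro q
    change (A.val) (MvPolynomial.aeval u' q) = _
    rw [← AlgHom.comp_apply, MvPolynomial.comp_aeval]
    rfl
  have hPF : ∀ q : P, ((algebraMap P A q : A) : K) ∈ F₁ := by
    intro q
    rw [halgPA, huA]
    have hmem : MvPolynomial.aeval u q ∈ Algebra.adjoin k (Set.range u) := by
      rw [Algebra.adjoin_range_eq_range_aeval]
      exact ⟨q, rfl⟩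
    exact IntermediateField.algebra_adjoin_le_adjoin k _ hmem
  obtain ⟨η, hηO, hgen, f, hfmon, hfcoeff, hfη, hfder⟩ :=
    henselDatum_of_standardEtalePresentation O A hAO F₁ hPF r hr1 Q
  -- (5) the base `O ∩ F₁` is rank one, residually rational and monomially rational; THEOREM D
  have hu00 : O.valuation (algebraMap F₁ K ⟨u 0, IntermediateField.subset_adjoin k _ ⟨0, rfl⟩⟩) < 1 :=
    (hmem𝔔 (u' 0)).mp (by
      have h := hmax ▸ (Ideal.subset_span ⟨0, rfl⟩ :
        algebraMap A (Localization.AtPrime (centreIdeal A O hAO)) (u' 0) ∈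
          Ideal.span (Set.range fun i =>
            algebraMap A (Localization.AtPrime (centreIdeal A O hAO)) (u' i)))
      exact (IsLocalization.AtPrime.to_map_mem_maximal_iff _ (centreIdeal A O hAO) (u' 0)).mp h)
  have hrF : Nonempty (O.comap (algebraMap F₁ K)).valuation.RankOne :=
    rankOne_comap (algebraMap F₁ K) O hr
      (c := ⟨u 0, IntermediateField.subset_adjoin k _ ⟨0, rfl⟩⟩)
      (fun h => hu0 0 (congrArg Subtype.val h)) hu00
  have hκF : ∀ z ∈ O.comap (algebraMap F₁ K), ∃ c : k,
      z - algebraMap k F₁ c ∈ (O.comap (algebraMap F₁ K)).nonunits := by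
    intro z hz
    obtain ⟨c, hc⟩ := hκ (algebraMap F₁ K z) (ValuationSubring.mem_comap.mp hz)
    refine ⟨c, ?_⟩
    rw [ValuationSubring.mem_nonunits_iff, comap_valuation_lt_one_iff, map_sub,
      ← IsScalarTower.algebraMap_apply k F₁ K c]
    exact (O.mem_nonunits_iff).mp hc
  have hMR : MonomiallyRational k (O.comap (algebraMap F₁ K)) :=
    monomiallyRational_comap_adjoin O u (fun i => hAO' (u' i)) hu0 hindu hind hspan
  have hkey : KeyChainTopBelow k (O.comap (algebraMap F₁ K)) :=
    hD F₁ (O.comap (algebraMap F₁ K)) hrF hκF hMR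
  exact ⟨F₁, η, IntermediateField.fg_adjoin_of_finite (Set.finite_range u), hkey, hηO, hgen, f, hfmon,
    hfcoeff, hfη, hfder⟩

/-! ### VI.5 (K-H) in the residual binders: the span clause from `¬ IsAbhyankarPlace` and `trdeg ≤ 4` -/

/-- **Adapted regular chart** of `(K, v)` over `k` — THEOREM H's hypothesis typed VERBATIM as in the g23
window («regular local essentially-of-finite-type `k`-subalgebra dominated by `O`, `Frac = K`, rsp
`u₀,…,u₃` with `v u₀, v u₁, v u₂` ℤ-independent»; the residue condition is the separate binder `hκ`): a
finitely generated `k`-subalgebra `A ⊆ O` with `Frac A = K` whose local ring at the centre is REGULAR of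
dimension `4` with maximal ideal generated by `u₀, …, u₃ ∈ A`, and `v u₀, v u₁, v u₂` ℤ-independent.  No
spanning clause: under the residual binders (`trdeg_k K ≤ 4`, non-Abhyankar) it is automatic
(`frame_spans_of_not_isAbhyankarPlace`). [folklore] -/
def AdaptedRegularChart (k : Type) [Field k] {K : Type} [Field K] [Algebra k K]
    (O : ValuationSubring K) : Prop :=
  ∃ (A : Subalgebra k K) (hAO : A.toSubring ≤ O.toSubring) (u : Fin 4 → K) (hu : ∀ i, u i ∈ A),
    A.FG ∧ IsFractionRing A K ∧
    IsRegularLocalRing (Localization.AtPrime (centreIdeal A O hAO)) ∧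
    ringKrullDim (Localization.AtPrime (centreIdeal A O hAO)) = 4 ∧
    IsLocalRing.maximalIdeal (Localization.AtPrime (centreIdeal A O hAO)) =
      Ideal.span (Set.range fun i =>
        algebraMap A (Localization.AtPrime (centreIdeal A O hAO)) ⟨u i, hu i⟩) ∧
    (∀ m : Fin 3 → ℤ, (∏ i : Fin 3, O.valuation (u (Fin.castSucc i)) ^ m i) = 1 → m = 0)

/-- **Rational rank `3` from non-Abhyankar in transcendence degree `≤ 4`.**  Let `k ⊆ O`,
`trdeg_k K ≤ 4`, and suppose `O` is NOT an Abhyankar place of `K | k`.  If `w₀, w₁, w₂ ∈ K^×` have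
ℤ-independent values, then every value `v x`, `x ≠ 0`, has a positive power in the group they generate.
PROOF: otherwise `w₀, w₁, w₂, x` have ℤ-independent values (hence values independent modulo `v k^× = 1`),
so they are algebraically independent over `k` (Knaf–Kuhlmann 2005 Thm. 2.1 / Bourbaki AC VI §10.3, tree
`algebraicIndependent_sumElim_of_valIndep`); as `trdeg_k K ≤ 4` every `z ∈ K` is algebraic over
`k(w, x)` (`AlgebraicIndependent.option_iff`, `cardinalMk_le_trdeg`), i.e. `O` IS an Abhyankar place with
`ρ = 4`, `τ = 0`. [KnafKuhlmann2005 = arXiv:math/0304201, Thm. 2.1] [folklore] -/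
theorem frame_spans_of_not_isAbhyankarPlace (O : ValuationSubring K)
    (hkO : ∀ c : k, algebraMap k K c ∈ O) (htr : Algebra.trdeg k K ≤ 4)
    (hnA : ¬ IsAbhyankarPlace O (algebraMap k K).fieldRange ⊤)
    (w : Fin 3 → K) (hw0 : ∀ i, w i ≠ 0)
    (hind : ∀ m : Fin 3 → ℤ, (∏ i : Fin 3, O.valuation (w i) ^ m i) = 1 → m = 0)
    (x : K) (hx0 : x ≠ 0) :
    ∃ E : ℕ, 0 < E ∧ ∃ m : Fin 3 → ℤ, O.valuation x ^ E = ∏ i : Fin 3, O.valuation (w i) ^ m i := by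
  classical
  by_contra hno
  push Not at hno
  apply hnA
  -- the vector `(w₀, w₁, w₂, x)`
  let xv : Fin 4 → K := Fin.snoc w x
  have hxv_cast : ∀ i : Fin 3, xv (Fin.castSucc i) = w i := fun i => Fin.snoc_castSucc ..
  have hxv_last : xv (Fin.last 3) = x := Fin.snoc_last ..
  have hxv0 : ∀ i, xv i ≠ 0 := fun i =>
    Fin.lastCases (motive := fun i => xv i ≠ 0) (by rw [hxv_last]; exact hx0)
      (fun j => by rw [hxv_cast]; exact hw0 j) i
  -- its values are ℤ-independent
  have hxvi : ∀ m : Fin 4 → ℤ, (∏ i, O.valuation (xv i) ^ m i) = 1 → m = 0 := by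
    intro m hm
    rw [Fin.prod_univ_castSucc] at hm
    simp only [hxv_cast, hxv_last] at hm
    rcases lt_trichotomy (m (Fin.last 3)) 0 with hneg | hzero | hpos
    · exfalso
      have h1 := eq_inv_of_mul_eq_one_right hm
      refine hno (-m (Fin.last 3)).toNat (by omega) (fun i => m (Fin.castSucc i)) ?_
      have hE : (((-m (Fin.last 3)).toNat : ℕ) : ℤ) = -m (Fin.last 3) := Int.toNat_of_nonneg (by omega)
      rw [← zpow_natCast, hE, zpow_neg, h1, inv_inv]
    · rw [hzero, zpow_zero, mul_one] at hm
      have h3 := hind (fun i => m (Fin.castSucc i)) hm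
      funext i
      refine Fin.lastCases (motive := fun i => m i = (0 : Fin 4 → ℤ) i) ?_ (fun j => ?_) i
      · simpa using hzero
      · simpa using congr_fun h3 j
    · exfalso
      have h1 := eq_inv_of_mul_eq_one_right hm
      refine hno (m (Fin.last 3)).toNat (by omega) (fun i => -m (Fin.castSucc i)) ?_
      have hE : (((m (Fin.last 3)).toNat : ℕ) : ℤ) = m (Fin.last 3) := Int.toNat_of_nonneg hpos.le
      rw [← zpow_natCast, hE, h1, ← Finset.prod_inv_distrib]
      refine Finset.prod_congr rfl fun i _ => ?_
      rw [zpow_neg]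
  -- the data of an Abhyankar place with `ρ = 4`, `τ = 0`
  set k' : Subfield K := (algebraMap k K).fieldRange with hk'def
  have hvk : ∀ b ∈ k', b ≠ 0 → O.valuation b = 1 := by
    rintro _ ⟨c, rfl⟩ hc0
    have hc : c ≠ 0 := fun h => hc0 (by rw [h, map_zero])
    have hcc : algebraMap k K c * algebraMap k K c⁻¹ = 1 := by rw [← map_mul, mul_inv_cancel₀ hc, map_one]
    exact (O.valuation_eq_one_iff ⟨_, hkO c⟩).mp (IsUnit.of_mul_eq_one ⟨_, hkO c⁻¹⟩ (Subtype.ext hcc))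
  have hxvi' : ∀ m : Fin 4 → ℤ,
      (∃ b ∈ k', (∏ i, O.valuation (xv i) ^ m i) = O.valuation b) → m = 0 := by
    rintro m ⟨b, hb, hmb⟩
    apply hxvi m
    have hP0 : (∏ i, O.valuation (xv i) ^ m i) ≠ 0 :=
      Finset.prod_ne_zero_iff.mpr fun i _ => zpow_ne_zero _ ((Valuation.ne_zero_iff _).mpr (hxv0 i))
    have hb0 : b ≠ 0 := by
      rintro rfl
      rw [map_zero] at hmb
      exact hP0 hmb
    rw [hmb, hvk b hb hb0]
  let y0 : Fin 0 → K := fun _ => 0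
  have hy0 : ∀ j, y0 j ∈ O := fun _ => O.zero_mem
  have hri : AlgebraicIndependent (resField O k') (fun j => residue O ⟨y0 j, hy0 j⟩) :=
    algebraicIndependent_empty_type_iff.mpr
      (algebraMap (resField O k') (ResidueField O)).injective
  refine ⟨4, 0, xv, y0, hy0, fun i => ⟨Subfield.mem_top _, hxv0 i⟩, fun j => j.elim0, hxvi', hri, ?_⟩
  intro z _
  -- `xv` is algebraically independent over `k'` (KK05 Thm 2.1), hence over `k`
  have hind' : AlgebraicIndependent k' (Sum.elim xv y0) :=
    algebraicIndependent_sumElim_of_valIndep O k' xv y0 hxv0 hxvi' hy0 hri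
  have hxk' : AlgebraicIndependent k' xv := by
    have h := hind'.comp Sum.inl Sum.inl_injective
    rwa [Sum.elim_comp_inl] at h
  have hxk : AlgebraicIndependent k xv :=
    AlgebraicIndependent.of_ringHom_of_comp_eq (x := xv) (algebraMap k K).rangeRestrictField
      (RingHom.id K) (by simpa [Function.comp_def] using hxk')
      (algebraMap k K).rangeRestrictField.injective (RingHom.ext fun c => rfl)
  -- `trdeg ≤ 4`: `z` is algebraic over `k[xv]`
  have halg : IsAlgebraic (Algebra.adjoin k (Set.range xv)) z := by
    by_contra htz
    have hopt : AlgebraicIndependent k (fun o : Option (Fin 4) => o.elim z xv) :=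
      AlgebraicIndependent.option_iff.mpr ⟨hxk, htz⟩
    have hcard := hopt.cardinalMk_le_trdeg
    have h5 : ((5 : ℕ) : Cardinal) ≤ ((4 : ℕ) : Cardinal) := by
      calc ((5 : ℕ) : Cardinal) = Cardinal.mk (Option (Fin 4)) := by
              norm_num [Cardinal.mk_option, Cardinal.mk_fin]
        _ ≤ Algebra.trdeg k K := hcard
        _ ≤ 4 := htr
        _ = ((4 : ℕ) : Cardinal) := by norm_num
    have h54 : (5 : ℕ) ≤ 4 := by exact_mod_cast h5
    omega
  -- enlarge the base ring `k[xv] ⊆ k'(xv)`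
  set L : IntermediateField k' K := IntermediateField.adjoin k' (Set.range xv ∪ Set.range y0) with hLdef
  have hkL : ∀ c : k, algebraMap k K c ∈ L := fun c =>
    L.algebraMap_mem (⟨algebraMap k K c, ⟨c, rfl⟩⟩ : k')
  let T : Subalgebra k K :=
    { carrier := (L : Set K)
      mul_mem' := fun ha hb => L.mul_mem ha hb
      one_mem' := L.one_mem
      add_mem' := fun ha hb => L.add_mem ha hb
      zero_mem' := L.zero_mem
      algebraMap_mem' := hkL }
  have hadj : Algebra.adjoin k (Set.range xv) ≤ T :=
    Algebra.adjoin_le fun _ hi => IntermediateField.subset_adjoin k' _ (Or.inl hi)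
  have hRL : (Algebra.adjoin k (Set.range xv)).toSubring ≤ L.toSubring := fun a ha => hadj ha
  letI algRL : Algebra (Algebra.adjoin k (Set.range xv)) L := (Subring.inclusion hRL).toAlgebra
  haveI : IsScalarTower (Algebra.adjoin k (Set.range xv)) L K :=
    IsScalarTower.of_algebraMap_eq fun _ => rfl
  have hinj : Function.Injective (algebraMap (Algebra.adjoin k (Set.range xv)) L) :=
    fun a b h => Subtype.ext (congrArg Subtype.val h :)
  exact halg.extendScalars hinj

/-- **Algebraic independence of the parameters of an adapted regular chart** (faithful flatness,
`exists_isStandardEtale_of_regularParameters`). [folklore] -/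
theorem algebraicIndependent_of_adaptedRegularChart (O : ValuationSubring K) (A : Subalgebra k K)
    (hAO : A.toSubring ≤ O.toSubring) (u : Fin 4 → K) (hu : ∀ i, u i ∈ A) (hAfg : A.FG)
    (hκ : ∀ y ∈ O, ∃ c : k, y - algebraMap k K c ∈ O.nonunits)
    (hreg : IsRegularLocalRing (Localization.AtPrime (centreIdeal A O hAO)))
    (hdim : ringKrullDim (Localization.AtPrime (centreIdeal A O hAO)) = 4)
    (hmax : IsLocalRing.maximalIdeal (Localization.AtPrime (centreIdeal A O hAO)) =
      Ideal.span (Set.range fun i =>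
        algebraMap A (Localization.AtPrime (centreIdeal A O hAO)) ⟨u i, hu i⟩)) :
    AlgebraicIndependent k u := by
  classical
  let P := MvPolynomial (Fin 4) k
  let u' : Fin 4 → A := fun i => ⟨u i, hu i⟩
  letI algPA : Algebra P A := (MvPolynomial.aeval u').toRingHom.toAlgebra
  have halgPA : ∀ q : P, algebraMap P A q = MvPolynomial.aeval u' q := fun _ => rfl
  haveI : IsScalarTower k P A := IsScalarTower.of_algebraMap_eq fun c => by
    rw [halgPA, MvPolynomial.algebraMap_eq, MvPolynomial.aeval_C]
  have hX : ∀ i, algebraMap P A (MvPolynomial.X i) = u' i := fun i => by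
    rw [halgPA, MvPolynomial.aeval_X]
  obtain ⟨hinjPA, -⟩ :=
    exists_isStandardEtale_of_regularParameters O A hAO u' hX hAfg hκ hreg hdim hmax
  rw [algebraicIndependent_iff_injective_aeval]
  have : MvPolynomial.aeval (R := k) u = A.val.comp (MvPolynomial.aeval u') := by
    rw [MvPolynomial.comp_aeval]
    rfl
  rw [this, AlgHom.coe_comp]
  exact Subtype.val_injective.comp hinjPA

/-- **(K-H) THEOREM H (⟸) in the residual binders** (g23 window item (K-H), verbatim shape
`<binders> → AdaptedRegularChart k O → HenselKeyChainTopBelow k O`, granted THEOREM D): for a rank-one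
valuation of `K | k` with `trdeg_k K ≤ 4`, NOT Abhyankar, residually rational (`κ = k`), every ADAPTED
REGULAR CHART lies in the Hensel cell.  The span clause of `ValueAdaptedRegularChart` is supplied by
`frame_spans_of_not_isAbhyankarPlace` (the parameters are algebraically independent, hence non-zero, by
`algebraicIndependent_of_adaptedRegularChart`), and `henselKeyChainTopBelow_of_adaptedRegularChart`
concludes. [Grothendieck1967, Prop. 18.4.6 (ii)] [KnafKuhlmann2005 = arXiv:math/0304201, Thm. 2.1]
[folklore] -/
theorem henselKeyChainTopBelow_of_adaptedRegularChart_residual (hD : TheoremD k)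
    (O : ValuationSubring K) (hr : Nonempty O.valuation.RankOne) (htr : Algebra.trdeg k K ≤ 4)
    (hnA : ¬ IsAbhyankarPlace O (algebraMap k K).fieldRange ⊤)
    (hκ : ∀ y ∈ O, ∃ c : k, y - algebraMap k K c ∈ O.nonunits)
    (hA : AdaptedRegularChart k O) : HenselKeyChainTopBelow k O := by
  obtain ⟨A, hAO, u, hu, hAfg, hfrac, hreg, hdim, hmax, hind⟩ := hA
  have hkO : ∀ c : k, algebraMap k K c ∈ O := fun c => hAO (A.algebraMap_mem c)
  have hindu : AlgebraicIndependent k u :=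
    algebraicIndependent_of_adaptedRegularChart O A hAO u hu hAfg hκ hreg hdim hmax
  exact henselKeyChainTopBelow_of_adaptedRegularChart hD O hr hκ
    ⟨A, hAO, u, hu, hAfg, hfrac, hreg, hdim, hmax, hind,
      frame_spans_of_not_isAbhyankarPlace O hkO htr hnA (fun i => u (Fin.castSucc i))
        (fun i => hindu.ne_zero _) hind⟩

end AdaptedChart

end Summit.ResolutionOfSingularities.ResolutionOfSingularities.Theorems.AdaptedChartHensel
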